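import Mathlib
import Summits.Ventures.PercRepro.TriangleCapThreeBand

/-!
# PercRepro — THE MAX-DEGREE LEMMA OF THE DENSE CORNER (p3, gen 40; part 154)

In a `K₄⁻`-free graph on `k ≥ 6` vertices with `m ≥ 3k − 8` edges every degree is `≤ k − 4`
(`deg_add_four_le_card_of_dense`). A vertex `x` of degree `d ≥ k − 3` has at most two non-neighbours; its
neighbourhood `N` induces a matching (`degIn N u ≤ 1`, `codeg ≤ 1`), a non-neighbour `y` is adjacent to at most
one end of each matching edge (`two_mul_degIn_add_adjPairs_le`: `2 degIn N y + adjPairs N ≤ 2d`), two adjacent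
non-neighbours share at most one neighbour in `N` (`degIn_add_degIn_le_of_adj_pair`), and the degree sum through
`S = N ∪ {x}` reads `2m = 2d + adjPairs N + 2 Σ_{y ∉ S} degIn N y + adjPairs Sᶜ`: with no non-neighbour
`2m ≤ 3d`, with one `2m ≤ 4d`, with two `2m ≤ 6d` or `≤ 5d + 4` — all below `6k − 16`. Axioms: standard.
-/

namespace PercRepro

namespace TriangleCap

namespace C047

open Finset

variable {V : Type*} [Fintype V] [DecidableEq V]

/-- A neighbour `u` of `x` has at most one neighbour inside `N(x)`. -/
theorem degIn_nbhd_le_one (D : SimpleGraph V) [DecidableRel D.Adj] (hK : K4mFree D) {x u : V}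
    (hxu : D.Adj x u) : degIn D (univ.filter (fun v => D.Adj x v)) u ≤ 1 := by
  have h := card_inter_le_one_of_adj D hK hxu
  unfold degIn
  rw [filter_filter]
  rw [← filter_and] at h
  exact h

/-- **ONE END OF EACH MATCHING EDGE:** for `y ≠ x`, `2 degIn N y + adjPairs N ≤ 2 |N|` (`N = N(x)`): the
`N`-neighbours of a vertex of `A = N ∩ N(y)` lie in `B = N ∖ A`, so `adjPairs N ≤ 2 Σ_B degIn N ≤ 2 |B|`. -/
theorem two_mul_degIn_add_adjPairs_le (D : SimpleGraph V) [DecidableRel D.Adj] (hK : K4mFree D) {x y : V}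
    (hne : y ≠ x) :
    2 * degIn D (univ.filter (fun v => D.Adj x v)) y + adjPairs D (univ.filter (fun v => D.Adj x v)) ≤
      2 * (univ.filter (fun v => D.Adj x v)).card := by
  obtain ⟨N, hN⟩ : ∃ N : Finset V, N = univ.filter (fun v => D.Adj x v) := ⟨_, rfl⟩
  rw [← hN]
  have hmemN : ∀ v, v ∈ N ↔ D.Adj x v := fun v => by rw [hN, mem_filter]; simp only [mem_univ, true_and]
  have hdeg1 : ∀ u ∈ N, degIn D N u ≤ 1 := fun u hu => by
    rw [hN]; exact degIn_nbhd_le_one D hK ((hmemN u).mp hu)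
  obtain ⟨A, hA⟩ : ∃ A : Finset V, A = N.filter (fun v => D.Adj y v) := ⟨_, rfl⟩
  have hAN : A ⊆ N := by rw [hA]; exact filter_subset _ _
  have hcardA : degIn D N y = A.card := by rw [hA]; rfl
  obtain ⟨B, hB⟩ : ∃ B : Finset V, B = N \ A := ⟨_, rfl⟩
  have hcardB : B.card + A.card = N.card := by
    rw [hB, card_sdiff_of_subset hAN]
    have := card_le_card hAN
    omega
  -- the `N`-neighbours of a vertex of `A` lie in `B`
  have hAB : ∀ u ∈ A, N.filter (fun v => D.Adj u v) ⊆ B.filter (fun v => D.Adj u v) := by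
    intro u hu v hv
    rw [mem_filter] at hv
    rw [hA, mem_filter] at hu
    rw [mem_filter, hB, mem_sdiff, hA, mem_filter]
    refine ⟨⟨hv.1, ?_⟩, hv.2⟩
    rintro ⟨-, hyv⟩
    -- `u, v ∈ N(x)`, `u ∼ v`, `y ∼ u`, `y ∼ v`: the triangle `u v x` and `y`
    exact not_adj_both D hK hv.2 (D.adj_symm ((hmemN u).mp hu.1)) (D.adj_symm ((hmemN v).mp hv.1))
      (fun h => hne h.symm) (D.adj_symm hu.2) (D.adj_symm hyv)
  have h1 : ∑ u ∈ A, degIn D N u ≤ ∑ u ∈ A, degIn D B u := by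
    apply sum_le_sum
    intro u hu
    unfold degIn
    exact card_le_card (hAB u hu)
  have h2 : ∑ u ∈ A, degIn D B u = ∑ v ∈ B, degIn D A v := sum_degIn_comm D A B
  have h3 : ∑ v ∈ B, degIn D A v ≤ ∑ v ∈ B, degIn D N v :=
    sum_le_sum (fun v _ => degIn_mono D hAN v)
  have h4 : ∑ v ∈ B, degIn D N v ≤ B.card := by
    calc ∑ v ∈ B, degIn D N v ≤ ∑ _v ∈ B, 1 :=
          sum_le_sum (fun v hv => hdeg1 v (by rw [hB, mem_sdiff] at hv; exact hv.1))
      _ = B.card := by rw [sum_const, smul_eq_mul, mul_one]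
  have hsplit : adjPairs D N = ∑ u ∈ A, degIn D N u + ∑ v ∈ B, degIn D N v := by
    rw [adjPairs_eq_sum_degIn, ← sum_sdiff hAN, ← hB, add_comm]
  omega

/-- **TWO ADJACENT NON-NEIGHBOURS** `y ∼ y'` of `x` share at most one neighbour in `N(x)`:
`degIn N y + degIn N y' ≤ |N| + 1`. -/
theorem degIn_add_degIn_le_of_adj_pair (D : SimpleGraph V) [DecidableRel D.Adj] (hK : K4mFree D) (N : Finset V)
    {y y' : V} (hyy' : D.Adj y y') : degIn D N y + degIn D N y' ≤ N.card + 1 := by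
  have h := card_inter_le_one_of_adj D hK hyy'
  have hsub : N.filter (fun v => D.Adj y v) ∩ N.filter (fun v => D.Adj y' v) ⊆
      (univ.filter (fun v => D.Adj y v)) ∩ (univ.filter (fun v => D.Adj y' v)) := by
    intro v hv
    rw [mem_inter, mem_filter, mem_filter] at hv
    rw [mem_inter, mem_filter, mem_filter]
    exact ⟨⟨mem_univ v, hv.1.2⟩, ⟨mem_univ v, hv.2.2⟩⟩
  have h1 := card_le_card hsub
  have h2 := card_union_add_card_inter (N.filter (fun v => D.Adj y v)) (N.filter (fun v => D.Adj y' v))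
  have h3 : N.filter (fun v => D.Adj y v) ∪ N.filter (fun v => D.Adj y' v) ⊆ N := by
    intro v hv
    rw [mem_union, mem_filter, mem_filter] at hv
    rcases hv with hv | hv <;> exact hv.1
  have h4 := card_le_card h3
  unfold degIn
  omega

/-- Every vertex of `N(x)` has at most one neighbour in `N(x)`: `adjPairs N(x) ≤ |N(x)|`. -/
theorem adjPairs_nbhd_le (D : SimpleGraph V) [DecidableRel D.Adj] (hK : K4mFree D) (x : V) :
    adjPairs D (univ.filter (fun v => D.Adj x v)) ≤ (univ.filter (fun v => D.Adj x v)).card := by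
  rw [adjPairs_eq_sum_degIn]
  calc ∑ u ∈ univ.filter (fun v => D.Adj x v), degIn D (univ.filter (fun v => D.Adj x v)) u ≤
        ∑ _u ∈ univ.filter (fun v => D.Adj x v), 1 :=
        sum_le_sum (fun u hu => degIn_nbhd_le_one D hK (mem_filter.mp hu).2)
    _ = (univ.filter (fun v => D.Adj x v)).card := by rw [sum_const, smul_eq_mul, mul_one]

/-- **THE MAX-DEGREE LEMMA:** `K₄⁻`-free, `k ≥ 6`, `m ≥ 3k − 8` ⇒ every degree is `≤ k − 4`. -/
theorem deg_add_four_le_card_of_dense (D : SimpleGraph V) [DecidableRel D.Adj] (hK : K4mFree D)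
    (hk : 6 ≤ Fintype.card V) (hm : 3 * Fintype.card V ≤ D.edgeFinset.card + 8) (x : V) :
    deg D x + 4 ≤ Fintype.card V := by
  by_contra hcon
  push Not at hcon
  obtain ⟨N, hN⟩ : ∃ N : Finset V, N = univ.filter (fun v => D.Adj x v) := ⟨_, rfl⟩
  have hdx : deg D x = N.card := by rw [hN]; rfl
  have hmemN : ∀ v, v ∈ N ↔ D.Adj x v := fun v => by rw [hN, mem_filter]; simp only [mem_univ, true_and]
  have hxN : x ∉ N := fun h => D.irrefl ((hmemN x).mp h)
  -- `S = N ∪ {x}`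
  have hScard : (insert x N).card = N.card + 1 := card_insert_of_notMem hxN
  have hSc : ((insert x N)ᶜ).card + N.card + 1 = Fintype.card V := by
    rw [card_compl, hScard]
    have := card_le_univ (insert x N)
    omega
  have hid := two_mul_card_edges_eq_adjPairs_add D (insert x N)
  -- `adjPairs S = 2 |N| + adjPairs N`
  have hadjS : adjPairs D (insert x N) = 2 * N.card + adjPairs D N := by
    rw [adjPairs_eq_sum_degIn, sum_insert hxN, adjPairs_eq_sum_degIn]
    have hx : degIn D (insert x N) x = N.card := by
      unfold degIn
      congr 1
      ext v
      rw [mem_filter, mem_insert, hmemN]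
      constructor
      · rintro ⟨-, h⟩; exact h
      · intro h; exact ⟨Or.inr h, h⟩
    have hu : ∀ u ∈ N, degIn D (insert x N) u = degIn D N u + 1 := by
      intro u hu
      unfold degIn
      rw [filter_insert, if_pos (D.adj_symm ((hmemN u).mp hu)), card_insert_of_notMem]
      intro h
      rw [mem_filter] at h
      exact hxN h.1
    rw [hx, sum_congr rfl hu, sum_add_distrib, sum_const, smul_eq_mul, mul_one]
    ring
  -- `degIn S y = degIn N y` for `y ∉ S`
  have hdegS : ∀ y ∈ (insert x N)ᶜ, degIn D (insert x N) y = degIn D N y := by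
    intro y hy
    rw [mem_compl, mem_insert, not_or] at hy
    unfold degIn
    rw [filter_insert, if_neg]
    intro h
    exact hy.2 ((hmemN y).mpr (D.adj_symm h))
  have hout : ∑ y ∈ (insert x N)ᶜ, degIn D (insert x N) y = ∑ y ∈ (insert x N)ᶜ, degIn D N y :=
    sum_congr rfl hdegS
  rw [hadjS, hout] at hid
  -- the non-neighbours
  have hnotadj : ∀ y ∈ (insert x N)ᶜ, y ≠ x ∧ ¬ D.Adj x y := by
    intro y hy
    rw [mem_compl, mem_insert, not_or] at hy
    exact ⟨hy.1, fun h => hy.2 ((hmemN y).mpr h)⟩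
  have hpair : ∀ y ∈ (insert x N)ᶜ, 2 * degIn D N y + adjPairs D N ≤ 2 * N.card := by
    intro y hy
    have := two_mul_degIn_add_adjPairs_le D hK (hnotadj y hy).1
    rwa [← hN] at this
  have hadjN : adjPairs D N ≤ N.card := by
    have := adjPairs_nbhd_le D hK x
    rwa [← hN] at this
  have hRcard : ((insert x N)ᶜ).card ≤ 2 := by omega
  -- the inner sum over the non-neighbours: `degIn Sᶜ y ≤ |Sᶜ| − 1`
  have hinner : ∑ y ∈ (insert x N)ᶜ, degIn D (insert x N)ᶜ y ≤
      ((insert x N)ᶜ).card * (((insert x N)ᶜ).card - 1) := by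
    calc ∑ y ∈ (insert x N)ᶜ, degIn D (insert x N)ᶜ y ≤ ∑ _y ∈ (insert x N)ᶜ, (((insert x N)ᶜ).card - 1) :=
          sum_le_sum (fun y hy => degIn_le_card_sub_one D hy)
      _ = ((insert x N)ᶜ).card * (((insert x N)ᶜ).card - 1) := by rw [sum_const, smul_eq_mul]
  rcases (show ((insert x N)ᶜ).card = 0 ∨ ((insert x N)ᶜ).card = 1 ∨ ((insert x N)ᶜ).card = 2 by omega)
    with h0 | h1 | h2
  · -- no non-neighbour: `2m = 2d + adjPairs N ≤ 3d`
    rw [card_eq_zero] at h0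
    rw [h0, sum_empty, sum_empty] at hid
    omega
  · -- one non-neighbour `y`: `2m ≤ 2d + adjPairs N + 2 degIn N y ≤ 4d`
    obtain ⟨y, hy⟩ := card_eq_one.mp h1
    have hyR : y ∈ (insert x N)ᶜ := by rw [hy]; exact mem_singleton_self y
    have hp := hpair y hyR
    rw [hy, sum_singleton, sum_singleton] at hid
    have hin : degIn D ({y} : Finset V) y = 0 := by
      unfold degIn
      rw [card_eq_zero, filter_eq_empty_iff]
      intro v hv
      rw [mem_singleton] at hv
      rw [hv]
      exact D.irrefl
    rw [hin] at hid
    omega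
  · -- two non-neighbours `y, y'`
    obtain ⟨y, y', hyy', hR⟩ := card_eq_two.mp h2
    have hyR : y ∈ (insert x N)ᶜ := by rw [hR]; exact mem_insert_self y {y'}
    have hy'R : y' ∈ (insert x N)ᶜ := by rw [hR]; exact mem_insert_of_mem (mem_singleton_self y')
    have hp := hpair y hyR
    have hp' := hpair y' hy'R
    rw [hR] at hid hinner
    rw [sum_pair hyy'] at hid
    rw [card_pair hyy'] at hinner
    by_cases hadj : D.Adj y y'
    · have hsh := degIn_add_degIn_le_of_adj_pair D hK N hadj
      omega
    · -- no edge inside `{y, y'}`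
      have hin : ∑ z ∈ ({y, y'} : Finset V), degIn D ({y, y'} : Finset V) z = 0 := by
        apply sum_eq_zero
        intro z hz
        unfold degIn
        rw [card_eq_zero, filter_eq_empty_iff]
        intro v hv
        rw [mem_insert, mem_singleton] at hz hv
        rcases hz with rfl | rfl <;> rcases hv with rfl | rfl
        · exact D.irrefl
        · exact hadj
        · exact fun h => hadj (D.adj_symm h)
        · exact D.irrefl
      rw [hin] at hid
      omega

end C047

end TriangleCap

end PercRepro
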